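import Literature.NumberTheory.Automorphic.UnitaryThreePHTowerRho            -- (F3c-β-ii) FILE B: `toQuotPow`, `flickerPHRho`, bridge, (H1), (H3)
import Literature.NumberTheory.Automorphic.UnitaryThreeDoubleCosetsHKStabilizer -- ★ (C2) B-p17: `flickerU_inv_mul_mul_flickerU_mem_unitaryInt_iff`
import HarnessLib

/-!
# The tower for Flicker's Prop. 8 (ii), FILE C: `P_H ∩ H^K_m ≤ N₀(ϖ^m)` and **`[N₀(ϖ^m) : P_H ∩ H^K_m] = #{β ∈ 𝒪⧸𝓂^m : σ̄β = −β}`** (H2)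
(Flicker, *Elementary proof of the fundamental lemma for a unitary group* (1998), Prop. 8 pp. 84–85)

Topic `NumberTheory/Automorphic`; namespace `Literature.NumberTheory.Automorphic.UnitaryGroup`.  THEOREMS ONLY (no `def`, no instance, no notation, no named fact,
no `sorry`).  Cell `pub/hodgecm-mathlib`, F0∕P3a road «N7-ns COUNT FROM FLICKER» (MAP v3, architect A-p06 (g26)), brick **(F3c-β-ii) PROP. 8 (ii)**, third file of the
tower `P_H ⊇ N₀(ϖ^m) ⊇ S := P_H ∩ H^K_m` (B-p04 (g33); plan + consumed heads fixed by the LAYER C pen A-p03 (g24) 04:45:33Z), over ★ FILE A `UnitaryThreePHTower`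
(p841106), ★ FILE B `UnitaryThreePHTowerRho` (p841210), ★ (C2) B-p17 `UnitaryThreeDoubleCosetsHKStabilizer`, ★ A-p03 `UnitaryThreeBorelCosetCount`.  With FILE B's (H1)(H3)
this gives PROP. 8 (ii): `[P_H : S] = [P_H : N₀]·[N₀ : S] = (q²−1)q^{2m−2}·q^m · q^m = (q²−1)q^{4m−2}` once the two class counts are read from ★ `natCard_units_quotient_pow` ∕
★ `natCard_antifixed_quotient_pow` (A-p03's currency).  HC_CM is proved only modulo the printed citations until rung 0 closes; structure theory for ONE clause of #103-ns.

* `coe_mul_of_coe_eq` — the product in coordinates `p(u,x,w)·p(u′,x′,w′) = p(uu′, x′ + x∕N(u′), ww′)`; `toQuotPow_add ∕ _neg ∕ _zero`, `quotientMap_toQuotPow`.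
* `mem_flickerHK_iff_of_coe_eq_borel` — ★ (C2) for `p(u₁,x,w) ∈ P_H`: `p ∈ H^K_m ↔ |u₁ − w| ≤ |ϖ^m| ∧ |(σu₁)⁻¹ − w| ≤ |ϖ^m| ∧ |u₁ + u₁x + (σu₁)⁻¹ − 2w| ≤ |ϖ^m|²`.
* **`inf_flickerHK_le_flickerPH0`** — (H2, inclusion) `flickerPH ⊓ flickerHK c u_m ≤ flickerPH0 c (ϖ^m)`.
* `exists_coe_eq_of_mem_flickerPH0` (coordinates on `N₀`), `v_mul_map_sub_one_le` (`|N(a) − 1| ≤ |a − 1|`).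
* **`index_inf_flickerHK_subgroupOf_flickerPH0`** — (H2) `((flickerPH ⊓ flickerHK c u_m).subgroupOf (flickerPH0 c (ϖ^m))).index = Nat.card {β : 𝒪[K] ⧸ 𝓂[K]^m // σ̄ β = −β}`
  with `σ̄ = Ideal.quotientMap (𝓂[K]^m) σO (maximalIdeal_pow_le_comap_codRestrict …)`, `σO := (σ.comp 𝒪[K].subtype).codRestrict 𝒪[K] hσO` (A-p03's tokens).
  PROOF: the character `χ(p(u₁,x,w)) := (x + a − σa)∕ϖ^m mod 𝓂^m`, `a = u₁w⁻¹`, is a homomorphism `N₀ → (𝒪⧸𝓂^m, +)` (crossed terms `x∕N(u₁′) − x`,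
  `(a−1)(a′−1) − (σa−1)(σa′−1)` are `O(ϖ^{2m})`), with kernel `S` (★ (C2)'s third congruence: `E·σa·w⁻¹ = ϖ^m·χ + R`, `|R| ≤ |ϖ^m|²`) and image the anti-fixed classes
  (`σχ = −χ`; `p(1, ϖ^m y, 1) ↦ ȳ`); then `Subgroup.index_ker`.

## References
* [Flicker1998UnitaryFL] Y. Z. Flicker, *Elementary proof of the fundamental lemma for a unitary group*, Canad. J. Math. 50 (1998), Prop. 8 pp. 84–85.
-/

open scoped MatrixGroups WithZero Valued
open Matrix

namespace Literature.NumberTheory.Automorphic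

namespace UnitaryGroup

open Literature.NumberTheory.Automorphic.HermitianLattice (unitaryInt mem_unitaryInt_iff LocalConjDatum)

section Algebra

variable {K : Type*} [Field K] [Valued K ℤᵐ⁰] {ϖ : K} (σ : K →+* K) {J : Matrix (Fin 3) (Fin 3) K}

omit [Valued K ℤᵐ⁰] in
/-- The product in `P_H`-coordinates: `p(u,x,w) · p(u′,x′,w′) = p(uu′, x′ + x∕(u′σu′), ww′)` — the `x`-slot is a crossed homomorphism.
[cite: Flicker1998UnitaryFL, Prop. 8 p. 84] -/
theorem coe_mul_of_coe_eq {p p' : ↥(unitaryGroupOfForm σ J)} {u x w u' x' w' : K}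
    (hcoe : ((p : GL (Fin 3) K) : Matrix (Fin 3) (Fin 3) K) = !![u, 0, u * x; 0, w, 0; 0, 0, (σ u)⁻¹])
    (hcoe' : ((p' : GL (Fin 3) K) : Matrix (Fin 3) (Fin 3) K) = !![u', 0, u' * x'; 0, w', 0; 0, 0, (σ u')⁻¹])
    (hu0' : u' ≠ 0) (hσu0' : σ u' ≠ 0) :
    (((p * p' : ↥(unitaryGroupOfForm σ J)) : GL (Fin 3) K) : Matrix (Fin 3) (Fin 3) K) =
      !![u * u', 0, (u * u') * (x' + x / (u' * σ u')); 0, w * w', 0; 0, 0, (σ (u * u'))⁻¹] := by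
  rw [Subgroup.coe_mul, Units.val_mul, hcoe, hcoe', map_mul]
  ext i j
  fin_cases i <;> fin_cases j <;> simp [Matrix.mul_apply, Fin.sum_univ_three]
  · field_simp
  · rw [mul_comm]

/-- `toQuotPow` is additive on integers. [cite: Flicker1998UnitaryFL, Prop. 8 p. 84] -/
theorem toQuotPow_add (m : ℕ) {y z : K} (hy : Valued.v y ≤ 1) (hz : Valued.v z ≤ 1) :
    toQuotPow m (y + z) = toQuotPow m y + toQuotPow m z := by
  rw [toQuotPow_of_le m hy, toQuotPow_of_le m hz, toQuotPow_of_le m (Valuation.map_add_le _ hy hz), ← map_add]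
  rfl

/-- `toQuotPow` of a negative. [cite: Flicker1998UnitaryFL, Prop. 8 p. 84] -/
theorem toQuotPow_neg (m : ℕ) {y : K} (hy : Valued.v y ≤ 1) :
    toQuotPow m (-y) = -toQuotPow m y := by
  rw [toQuotPow_of_le m hy, toQuotPow_of_le m (by rwa [Valuation.map_neg] : Valued.v (-y) ≤ 1), ← map_neg]
  rfl

/-- `toQuotPow m 0 = 0`. [cite: Flicker1998UnitaryFL, Prop. 8 p. 84] -/
theorem toQuotPow_zero (m : ℕ) : toQuotPow m (0 : K) = 0 := by
  rw [toQuotPow_of_le m (by rw [map_zero]; exact zero_le : Valued.v (0 : K) ≤ 1), ← (Ideal.Quotient.mk (𝓂[K] ^ m)).map_zero]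
  rfl

/-- The reduction of `σ` acts on `toQuotPow` through `σ`. [cite: Flicker1998UnitaryFL, Prop. 8 p. 84] -/
theorem quotientMap_toQuotPow (hϖ : Valued.v ϖ = WithZero.exp (-1 : ℤ)) (hσv : ∀ a, Valued.v (σ a) = Valued.v a)
    (hσO : ∀ y : 𝒪[K], (σ.comp 𝒪[K].subtype) y ∈ 𝒪[K]) (m : ℕ) {y : K} (hy : Valued.v y ≤ 1) :
    Ideal.quotientMap (𝓂[K] ^ m) ((σ.comp 𝒪[K].subtype).codRestrict 𝒪[K] hσO) (maximalIdeal_pow_le_comap_codRestrict σ hϖ hσv hσO m)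
      (toQuotPow m y) = toQuotPow m (σ y) := by
  rw [toQuotPow_of_le m hy, toQuotPow_of_le m (by rw [hσv]; exact hy : Valued.v (σ y) ≤ 1), Ideal.quotientMap_mk]
  rfl

end Algebra

section HTwo

variable {K : Type*} [Field K] [Valued K ℤᵐ⁰] {ϖ : K} (σ : K →+* K) {J : Matrix (Fin 3) (Fin 3) K} (hJ : J = (StdForm.antidiagonal 3).over K)

include hJ in
/-- ★ (C2) for an element of `P_H` in coordinates: `p(u₁,x,w) ∈ H^K_m ↔ |u₁ − w| ≤ |ϖ^m| ∧ |(σu₁)⁻¹ − w| ≤ |ϖ^m| ∧ |u₁ + u₁x + (σu₁)⁻¹ − 2w| ≤ |ϖ^m|²`.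
[cite: Flicker1998UnitaryFL, Prop. 8 pp. 84–85] -/
theorem mem_flickerHK_iff_of_coe_eq_borel (hd : LocalConjDatum σ ϖ) {y : K} (hy : y * σ y = -2) (m : ℕ)
    {um c p : ↥(unitaryGroupOfForm σ J)}
    (hum : ((um : GL (Fin 3) K) : Matrix (Fin 3) (Fin 3) K) = !![ϖ ^ m, y, (ϖ ^ m)⁻¹; 0, 1, -σ y * (ϖ ^ m)⁻¹; 0, 0, (ϖ ^ m)⁻¹])
    (hp : p ∈ flickerPH σ J c) {u₁ x w : K}
    (hcoe : ((p : GL (Fin 3) K) : Matrix (Fin 3) (Fin 3) K) = !![u₁, 0, u₁ * x; 0, w, 0; 0, 0, (σ u₁)⁻¹]) :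
    p ∈ flickerHK σ J c um ↔ Valued.v (u₁ - w) ≤ Valued.v (ϖ ^ m) ∧ Valued.v ((σ u₁)⁻¹ - w) ≤ Valued.v (ϖ ^ m) ∧
      Valued.v (u₁ + u₁ * x + (σ u₁)⁻¹ - 2 * w) ≤ Valued.v (ϖ ^ m) * Valued.v (ϖ ^ m) := by
  have hH : p ∈ Subgroup.centralizer ({c} : Set ↥(unitaryGroupOfForm σ J)) := (mem_flickerKH_iff.1 (mem_flickerPH_iff'.1 hp).1).1
  rw [mem_flickerHK_iff, flickerU_inv_mul_mul_flickerU_mem_unitaryInt_iff σ hJ hd hy m hum hcoe]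
  simp only [hH, true_and, map_zero, zero_le, add_zero, zero_add]

include hJ in
/-- **(H2, inclusion) `P_H ∩ H^K_m ≤ N₀(ϖ^m)`**: on `P_H ∩ H^K_m`, `u₁ ≡ w` and `x ≡ 0 (mod ϖ^m)` (the latter from the three congruences of ★ (C2):
`u₁x = E − (u₁ − w) − ((σu₁)⁻¹ − w)`). [cite: Flicker1998UnitaryFL, Prop. 8 pp. 84–85] -/
theorem inf_flickerHK_le_flickerPH0 (hd : LocalConjDatum σ ϖ) {y : K} (hy : y * σ y = -2) (m : ℕ)
    {um c : ↥(unitaryGroupOfForm σ J)}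
    (hum : ((um : GL (Fin 3) K) : Matrix (Fin 3) (Fin 3) K) = !![ϖ ^ m, y, (ϖ ^ m)⁻¹; 0, 1, -σ y * (ϖ ^ m)⁻¹; 0, 0, (ϖ ^ m)⁻¹])
    (hc : ((c : GL (Fin 3) K) : Matrix (Fin 3) (Fin 3) K) = !![1, 0, 0; 0, -1, 0; 0, 0, 1]) :
    flickerPH σ J c ⊓ flickerHK σ J c um ≤ flickerPH0 σ J c (ϖ ^ m) := by
  rintro p ⟨hp, hK⟩
  obtain ⟨u₁, x, w, hcoe, hu, hx, -, hw, hσw⟩ := exists_coe_eq_borel_of_mem_flickerPH σ hJ hd hc hp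
  obtain ⟨h1, h2, h3⟩ := (mem_flickerHK_iff_of_coe_eq_borel σ hJ hd hy m hum hp hcoe).1 hK
  have hw0 : w ≠ 0 := fun h => by rw [h, map_zero] at hw; exact zero_ne_one hw
  have hϖ1 : Valued.v ϖ ≤ 1 := by rw [hd.vϖ, ← WithZero.exp_zero]; exact WithZero.exp_le_exp.2 (by norm_num)
  have ht1 : Valued.v (ϖ ^ m) ≤ 1 := by rw [map_pow]; exact pow_le_one' hϖ1 m
  refine (mem_flickerPH0_iff_of_coe_eq σ hJ hd.vσ hd.σσ hp hcoe hu hw hσw (ϖ ^ m)).2 ⟨?_, ?_⟩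
  · rw [show u₁ * w⁻¹ - 1 = (u₁ - w) * w⁻¹ by field_simp, map_mul, map_inv₀, hw, inv_one, mul_one]; exact h1
  · have e : x = u₁⁻¹ * ((u₁ + u₁ * x + (σ u₁)⁻¹ - 2 * w) - (u₁ - w) - ((σ u₁)⁻¹ - w)) := by
      have hu0 : u₁ ≠ 0 := fun h => by rw [h, map_zero] at hu; exact zero_ne_one hu
      field_simp; ring
    rw [e, map_mul, map_inv₀, hu, inv_one, one_mul]
    exact Valuation.map_sub_le _ (Valuation.map_sub_le _ (h3.trans ((mul_le_mul' ht1 le_rfl).trans (by rw [one_mul]))) h1) h2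

end HTwo

section Index

variable {K : Type*} [Field K] [Valued K ℤᵐ⁰] {ϖ : K} (σ : K →+* K) {J : Matrix (Fin 3) (Fin 3) K} (hJ : J = (StdForm.antidiagonal 3).over K)

include hJ in
/-- Coordinates of an element of `N₀(t)`: `p = p(u₁, x, w)` with `|u₁ w⁻¹ − 1| ≤ |t|`, `|x| ≤ |t|` (★ `exists_coe_eq_borel_of_mem_flickerPH` + ★ `mem_flickerPH0_iff_of_coe_eq`).
[cite: Flicker1998UnitaryFL, Prop. 8 pp. 84–85] -/
theorem exists_coe_eq_of_mem_flickerPH0 (hd : LocalConjDatum σ ϖ) {c p : ↥(unitaryGroupOfForm σ J)}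
    (hc : ((c : GL (Fin 3) K) : Matrix (Fin 3) (Fin 3) K) = !![1, 0, 0; 0, -1, 0; 0, 0, 1]) {t : K} (hp : p ∈ flickerPH0 σ J c t) :
    ∃ u₁ x w : K, ((p : GL (Fin 3) K) : Matrix (Fin 3) (Fin 3) K) = !![u₁, 0, u₁ * x; 0, w, 0; 0, 0, (σ u₁)⁻¹] ∧
      Valued.v u₁ = 1 ∧ Valued.v x ≤ 1 ∧ σ x = -x ∧ Valued.v w = 1 ∧ σ w * w = 1 ∧
      Valued.v (u₁ * w⁻¹ - 1) ≤ Valued.v t ∧ Valued.v x ≤ Valued.v t := by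
  have hP : p ∈ flickerPH σ J c := flickerPH0_le c t hp
  obtain ⟨u₁, x, w, hcoe, hu, hx, hσx, hw, hσw⟩ := exists_coe_eq_borel_of_mem_flickerPH σ hJ hd hc hP
  obtain ⟨h1, h2⟩ := (mem_flickerPH0_iff_of_coe_eq σ hJ hd.vσ hd.σσ hP hcoe hu hw hσw t).1 hp
  exact ⟨u₁, x, w, hcoe, hu, hx, hσx, hw, hσw, h1, h2⟩

/-- `|N(a) − 1| ≤ |a − 1|` for `|a| ≤ 1` (`N(a) = a·σa`, `σ` isometric): `aσa − 1 = (a − 1)σa + (σa − 1)`. [cite: Flicker1998UnitaryFL, Prop. 8 p. 84] -/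
theorem v_mul_map_sub_one_le (hσv : ∀ a, Valued.v (σ a) = Valued.v a) {a : K} (ha : Valued.v a ≤ 1) :
    Valued.v (a * σ a - 1) ≤ Valued.v (a - 1) := by
  have e : a * σ a - 1 = (a - 1) * σ a + (σ a - 1) := by ring
  rw [e]
  refine Valuation.map_add_le _ ?_ ?_
  · rw [map_mul, hσv]; exact (mul_le_mul' le_rfl ha).trans (by rw [mul_one])
  · rw [show σ a - 1 = σ (a - 1) by rw [map_sub, map_one], hσv]

include hJ in
/-- **(H2) FLICKER'S PROP. 8 (ii), THE SECOND STEP OF THE TOWER: `[N₀(ϖ^m) : P_H ∩ H^K_m] = #{β ∈ 𝒪⧸𝓂^m : σ̄β = −β}`** (`= q^m` by ★ A-p03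
`natCard_antifixed_quotient_pow`).  PROOF: on `N₀ = N₀(ϖ^m)` the map `χ(p(u₁,x,w)) := (x + a − σa)∕ϖ^m mod 𝓂^m`, `a = u₁w⁻¹` (`= x∕ϖ^m + z − σz` for `a = 1 + ϖ^m z`),
is a homomorphism to `(𝒪⧸𝓂^m, +)` (the crossed term `x∕N(u₁′) − x` and `(a−1)(a′−1) − (σa−1)(σa′−1)` are `O(ϖ^{2m})`), its kernel is `P_H ∩ H^K_m` (★ (C2)'s third
congruence: `E·σa·w⁻¹ = ϖ^m χ + R`, `|R| ≤ |ϖ^m|²`, `E = u₁ + u₁x + (σu₁)⁻¹ − 2w`), and its image is exactly the anti-fixed classes (`σχ = −χ`; `p(1, ϖ^m y, 1) ↦ ȳ`).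
[cite: Flicker1998UnitaryFL, Prop. 8 pp. 84–85] -/
theorem index_inf_flickerHK_subgroupOf_flickerPH0 (hd : LocalConjDatum σ ϖ) {y : K} (hy : y * σ y = -2)
    (hσO : ∀ z : 𝒪[K], (σ.comp 𝒪[K].subtype) z ∈ 𝒪[K]) (m : ℕ) {um c : ↥(unitaryGroupOfForm σ J)}
    (hum : ((um : GL (Fin 3) K) : Matrix (Fin 3) (Fin 3) K) = !![ϖ ^ m, y, (ϖ ^ m)⁻¹; 0, 1, -σ y * (ϖ ^ m)⁻¹; 0, 0, (ϖ ^ m)⁻¹])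
    (hc : ((c : GL (Fin 3) K) : Matrix (Fin 3) (Fin 3) K) = !![1, 0, 0; 0, -1, 0; 0, 0, 1]) :
    ((flickerPH σ J c ⊓ flickerHK σ J c um).subgroupOf (flickerPH0 σ J c (ϖ ^ m))).index =
      Nat.card {β : 𝒪[K] ⧸ 𝓂[K] ^ m //
        Ideal.quotientMap (𝓂[K] ^ m) ((σ.comp 𝒪[K].subtype).codRestrict 𝒪[K] hσO)
          (maximalIdeal_pow_le_comap_codRestrict σ hd.vϖ hd.vσ hσO m) β = -β} := by
  have hσσ : ∀ a, σ (σ a) = a := hd.σσ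
  have hσv : ∀ a, Valued.v (σ a) = Valued.v a := hd.vσ
  have h2v : Valued.v (2 : K) = 1 := hd.v2
  have h2 : (2 : K) ≠ 0 := fun h => by rw [h, map_zero] at h2v; exact zero_ne_one h2v
  have hϖ0 : ϖ ≠ 0 := fun h => by have := hd.vϖ; rw [h, map_zero] at this; exact WithZero.zero_ne_coe this
  set t : K := ϖ ^ m with ht
  have ht0 : t ≠ 0 := pow_ne_zero _ hϖ0
  have vt0 : 0 < Valued.v t := (Valuation.pos_iff _).2 ht0
  have hϖ1 : Valued.v ϖ ≤ 1 := by rw [hd.vϖ, ← WithZero.exp_zero]; exact WithZero.exp_le_exp.2 (by norm_num)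
  have ht1 : Valued.v t ≤ 1 := by rw [ht, map_pow]; exact pow_le_one' hϖ1 m
  have hσt : σ t = t := by rw [ht, map_pow, hd.σϖ]
  set σq := Ideal.quotientMap (𝓂[K] ^ m) ((σ.comp 𝒪[K].subtype).codRestrict 𝒪[K] hσO)
    (maximalIdeal_pow_le_comap_codRestrict σ hd.vϖ hd.vσ hσO m) with hσq
  -- the character `χ` on matrices
  let chi : ↥(unitaryGroupOfForm σ J) → K := fun p =>
    (((p : GL (Fin 3) K) : Matrix (Fin 3) (Fin 3) K) 0 2 * (((p : GL (Fin 3) K) : Matrix (Fin 3) (Fin 3) K) 0 0)⁻¹ +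
      ((p : GL (Fin 3) K) : Matrix (Fin 3) (Fin 3) K) 0 0 * (((p : GL (Fin 3) K) : Matrix (Fin 3) (Fin 3) K) 1 1)⁻¹ -
      σ (((p : GL (Fin 3) K) : Matrix (Fin 3) (Fin 3) K) 0 0 * (((p : GL (Fin 3) K) : Matrix (Fin 3) (Fin 3) K) 1 1)⁻¹)) / t
  have hchi : ∀ (p : ↥(unitaryGroupOfForm σ J)) (u₁ x w : K),
      ((p : GL (Fin 3) K) : Matrix (Fin 3) (Fin 3) K) = !![u₁, 0, u₁ * x; 0, w, 0; 0, 0, (σ u₁)⁻¹] → u₁ ≠ 0 →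
      chi p = (x + u₁ * w⁻¹ - σ (u₁ * w⁻¹)) / t := by
    intro p u₁ x w hcoe hu0
    simp only [chi, hcoe]
    simp [mul_comm u₁ x]
    rw [mul_inv_cancel_right₀ hu0]
  -- `χ` in coordinates: integrality, anti-fixedness
  have hchi_v : ∀ {u₁ x w : K}, Valued.v u₁ = 1 → Valued.v w = 1 → Valued.v (u₁ * w⁻¹ - 1) ≤ Valued.v t → Valued.v x ≤ Valued.v t →
      Valued.v (x + u₁ * w⁻¹ - σ (u₁ * w⁻¹)) ≤ Valued.v t := by
    intro u₁ x w hu hw h1 h2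
    have e : x + u₁ * w⁻¹ - σ (u₁ * w⁻¹) = x + (u₁ * w⁻¹ - 1) - (σ (u₁ * w⁻¹) - 1) := by ring
    rw [e]
    refine Valuation.map_sub_le _ (Valuation.map_add_le _ h2 h1) ?_
    rw [show σ (u₁ * w⁻¹) - 1 = σ (u₁ * w⁻¹ - 1) by rw [map_sub, map_one], hσv]; exact h1
  -- the homomorphism
  let f : ↥(flickerPH0 σ J c t) →* Multiplicative (𝒪[K] ⧸ 𝓂[K] ^ m) :=
    { toFun := fun p => Multiplicative.ofAdd (toQuotPow m (chi p))
      map_one' := by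
        change Multiplicative.ofAdd (toQuotPow m (chi 1)) = 1
        have h1 : chi 1 = 0 := by
          simp only [chi, OneMemClass.coe_one, Units.val_one]
          simp [Matrix.one_apply_ne (show (0 : Fin 3) ≠ 2 by decide)]
        rw [h1, toQuotPow_zero, ofAdd_zero]
      map_mul' := by
        intro p p'
        change Multiplicative.ofAdd (toQuotPow m (chi (p * p' : ↥(unitaryGroupOfForm σ J)))) =
          Multiplicative.ofAdd (toQuotPow m (chi p)) * Multiplicative.ofAdd (toQuotPow m (chi p'))
        obtain ⟨u₁, x, w, hcoe, hu, hx, -, hw, hσw, ha, hxt⟩ := exists_coe_eq_of_mem_flickerPH0 σ hJ hd hc p.2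
        obtain ⟨u₁', x', w', hcoe', hu', hx', -, hw', hσw', ha', hxt'⟩ := exists_coe_eq_of_mem_flickerPH0 σ hJ hd hc p'.2
        have hu0 : u₁ ≠ 0 := fun h => by rw [h, map_zero] at hu; exact zero_ne_one hu
        have hu0' : u₁' ≠ 0 := fun h => by rw [h, map_zero] at hu'; exact zero_ne_one hu'
        have hw0 : w ≠ 0 := fun h => by rw [h, map_zero] at hw; exact zero_ne_one hw
        have hw0' : w' ≠ 0 := fun h => by rw [h, map_zero] at hw'; exact zero_ne_one hw'
        have hσu0' : σ u₁' ≠ 0 := fun h => hu0' (by rw [← hσσ u₁', h, map_zero])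
        have hcoe'' := coe_mul_of_coe_eq σ hcoe hcoe' hu0' hσu0'
        have c1 := hchi p u₁ x w hcoe hu0
        have c2 := hchi p' u₁' x' w' hcoe' hu0'
        have c3 := hchi (p * p' : ↥(unitaryGroupOfForm σ J)) (u₁ * u₁') (x' + x / (u₁' * σ u₁')) (w * w') hcoe'' (mul_ne_zero hu0 hu0')
        have i1 := hchi_v hu hw ha hxt
        have i2 := hchi_v hu' hw' ha' hxt'
        have i1' : Valued.v (chi p) ≤ 1 := by rw [c1, map_div₀, div_le_one₀ vt0]; exact i1
        have i2' : Valued.v (chi p') ≤ 1 := by rw [c2, map_div₀, div_le_one₀ vt0]; exact i2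
        rw [← ofAdd_add, ← toQuotPow_add m i1' i2']
        congr 1
        have i3' : Valued.v (chi (p * p' : ↥(unitaryGroupOfForm σ J))) ≤ 1 := by
          have hmem : (p * p' : ↥(unitaryGroupOfForm σ J)) ∈ flickerPH0 σ J c t := Subgroup.mul_mem _ p.2 p'.2
          obtain ⟨U, X, W, hC, hU, hX, -, hW, -, hA, hXt⟩ := exists_coe_eq_of_mem_flickerPH0 σ hJ hd hc hmem
          rw [hchi _ U X W hC (fun h => by rw [h, map_zero] at hU; exact zero_ne_one hU), map_div₀, div_le_one₀ vt0]
          exact hchi_v hU hW hA hXt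
        rw [toQuotPow_eq_toQuotPow_iff hd.vϖ m i3' (Valuation.map_add_le _ i1' i2'), c1, c2, c3]
        -- the crossed terms are `O(t²)`
        set a : K := u₁ * w⁻¹ with ha_def
        set a' : K := u₁' * w'⁻¹ with ha_def'
        have hN : Valued.v (x / (u₁' * σ u₁') - x) ≤ Valued.v t * Valued.v t := by
          have hsw' : σ w' = w'⁻¹ := by rw [← mul_eq_one_iff_eq_inv₀ hw0']; exact hσw'
          have e : x / (u₁' * σ u₁') - x = -(x * (u₁' * σ u₁')⁻¹) * (a' * σ a' - 1) := by
            rw [ha_def', map_mul, map_inv₀, hsw', inv_inv]; field_simp; ring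
          rw [e, map_mul, Valuation.map_neg, map_mul, map_inv₀, map_mul, hσv, hu', mul_one, inv_one, mul_one]
          refine mul_le_mul' hxt ((v_mul_map_sub_one_le σ hσv ?_).trans ha')
          rw [ha_def', map_mul, map_inv₀, hu', hw', inv_one, mul_one]
        have e : (x' + x / (u₁' * σ u₁') + u₁ * u₁' * (w * w')⁻¹ - σ (u₁ * u₁' * (w * w')⁻¹)) / t -
            ((x + a - σ a) / t + (x' + a' - σ a') / t) =
            ((x / (u₁' * σ u₁') - x) + (a - 1) * (a' - 1) - (σ a - 1) * (σ a' - 1)) / t := by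
          rw [ha_def, ha_def']; simp only [map_mul, map_inv₀]; field_simp; ring
        rw [e, map_div₀, div_le_iff₀ vt0]
        refine Valuation.map_sub_le _ (Valuation.map_add_le _ hN ?_) ?_
        · rw [map_mul]; exact mul_le_mul' ha ha'
        · have e4 : (σ a - 1) * (σ a' - 1) = σ ((a - 1) * (a' - 1)) := by simp only [map_mul, map_sub, map_one]
          rw [e4, hσv, map_mul]
          exact mul_le_mul' ha ha' }
  -- the kernel of `f` is `P_H ∩ H^K_m`
  have hker : f.ker = (flickerPH σ J c ⊓ flickerHK σ J c um).subgroupOf (flickerPH0 σ J c t) := by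
    ext p
    rw [MonoidHom.mem_ker, Subgroup.mem_subgroupOf, Subgroup.mem_inf]
    change Multiplicative.ofAdd (toQuotPow m (chi p)) = 1 ↔ _
    have hP : (p : ↥(unitaryGroupOfForm σ J)) ∈ flickerPH σ J c := flickerPH0_le c t p.2
    obtain ⟨u₁, x, w, hcoe, hu, hx, -, hw, hσw, ha, hxt⟩ := exists_coe_eq_of_mem_flickerPH0 σ hJ hd hc p.2
    have hu0 : u₁ ≠ 0 := fun h => by rw [h, map_zero] at hu; exact zero_ne_one hu
    have hw0 : w ≠ 0 := fun h => by rw [h, map_zero] at hw; exact zero_ne_one hw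
    have hσu0 : σ u₁ ≠ 0 := fun h => hu0 (by rw [← hσσ u₁, h, map_zero])
    have hsw : σ w = w⁻¹ := by rw [← mul_eq_one_iff_eq_inv₀ hw0]; exact hσw
    have c1 := hchi p u₁ x w hcoe hu0
    have i1 : Valued.v (chi p) ≤ 1 := by rw [c1, map_div₀, div_le_one₀ vt0]; exact hchi_v hu hw ha hxt
    rw [← ofAdd_zero, Multiplicative.ofAdd.apply_eq_iff_eq, ← toQuotPow_zero m,
      toQuotPow_eq_toQuotPow_iff hd.vϖ m i1 (by rw [map_zero]; exact zero_le), sub_zero,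
      mem_flickerHK_iff_of_coe_eq_borel σ hJ hd hy m hum hP hcoe, and_iff_right hP]
    set a : K := u₁ * w⁻¹ with ha_def
    -- the first two congruences hold on `N₀`
    have k1 : Valued.v (u₁ - w) ≤ Valued.v t := by
      rw [show u₁ - w = (a - 1) * w by rw [ha_def]; field_simp, map_mul, hw, mul_one]; exact ha
    have k2 : Valued.v ((σ u₁)⁻¹ - w) ≤ Valued.v t := by
      have e : (σ u₁)⁻¹ - w = -((σ u₁)⁻¹ * w) * σ (u₁ - w) := by rw [map_sub, hsw]; field_simp; ring
      rw [e, map_mul, Valuation.map_neg, map_mul, map_inv₀, hσv, hu, inv_one, one_mul, hw, one_mul, hσv]; exact k1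
    -- the third: `E·σa·w⁻¹ = t·χ + R`
    have va : Valued.v a = 1 := by rw [ha_def, map_mul, map_inv₀, hu, hw, inv_one, mul_one]
    have vσa : Valued.v (σ a) = 1 := by rw [hσv, va]
    have hσa0 : σ a ≠ 0 := fun h => by rw [h, map_zero] at vσa; exact zero_ne_one vσa
    have eE : (u₁ + u₁ * x + (σ u₁)⁻¹ - 2 * w) * (σ a * w⁻¹) =
        t * ((x + a - σ a) / t) + ((a - 1) * (σ a - 1) + x * (a * σ a - 1)) := by
      rw [ha_def, map_mul, map_inv₀, hsw, inv_inv]; field_simp; ring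
    have hR : Valued.v ((a - 1) * (σ a - 1) + x * (a * σ a - 1)) ≤ Valued.v t * Valued.v t := by
      refine Valuation.map_add_le _ ?_ ?_
      · have e4 : (a - 1) * (σ a - 1) = (a - 1) * σ (a - 1) := by simp only [map_sub, map_one]
        rw [e4, map_mul, hσv]; exact mul_le_mul' ha ha
      · rw [map_mul]; exact mul_le_mul' hxt ((v_mul_map_sub_one_le σ hσv va.le).trans ha)
    have key : Valued.v (u₁ + u₁ * x + (σ u₁)⁻¹ - 2 * w) = Valued.v (t * ((x + a - σ a) / t) + ((a - 1) * (σ a - 1) + x * (a * σ a - 1))) := by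
      rw [← eE, map_mul, map_mul, map_inv₀, vσa, hw, inv_one, mul_one, mul_one]
    rw [← c1] at key
    rw [key, and_iff_right k1, and_iff_right k2]
    constructor
    · intro h
      refine Valuation.map_add_le _ ?_ hR
      rw [map_mul]; exact mul_le_mul' le_rfl h
    · intro h
      have h' : Valued.v (t * chi p) ≤ Valued.v t * Valued.v t := by
        have e : t * chi p = (t * chi p + ((a - 1) * (σ a - 1) + x * (a * σ a - 1))) - ((a - 1) * (σ a - 1) + x * (a * σ a - 1)) := by ring
        rw [e]; exact Valuation.map_sub_le _ h hR
      rw [map_mul] at h'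
      calc Valued.v (chi p) = (Valued.v t)⁻¹ * (Valued.v t * Valued.v (chi p)) := by rw [inv_mul_cancel_left₀ vt0.ne']
        _ ≤ (Valued.v t)⁻¹ * (Valued.v t * Valued.v t) := mul_le_mul' le_rfl h'
        _ = Valued.v t := by rw [inv_mul_cancel_left₀ vt0.ne']
  -- the image of `f` is the anti-fixed classes
  have hrange : ∀ g : Multiplicative (𝒪[K] ⧸ 𝓂[K] ^ m), g ∈ f.range ↔ σq (Multiplicative.toAdd g) = -Multiplicative.toAdd g := by
    intro g
    constructor
    · rintro ⟨p, rfl⟩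
      change σq (toQuotPow m (chi p)) = -toQuotPow m (chi p)
      obtain ⟨u₁, x, w, hcoe, hu, hx, hσx, hw, hσw, ha, hxt⟩ := exists_coe_eq_of_mem_flickerPH0 σ hJ hd hc p.2
      have hu0 : u₁ ≠ 0 := fun h => by rw [h, map_zero] at hu; exact zero_ne_one hu
      have c1 := hchi p u₁ x w hcoe hu0
      have i1 : Valued.v (chi p) ≤ 1 := by rw [c1, map_div₀, div_le_one₀ vt0]; exact hchi_v hu hw ha hxt
      rw [hσq, quotientMap_toQuotPow σ hd.vϖ hσv hσO m i1, ← toQuotPow_neg m i1]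
      congr 1
      rw [c1, map_div₀, hσt, map_sub, map_add, hσσ, hσx]; ring
    · intro hg
      obtain ⟨b, hb⟩ := Ideal.Quotient.mk_surjective (Multiplicative.toAdd g)
      -- lift the class to an exactly anti-fixed `y₀`, and take `p(1, t y₀, 1)`
      set y₀ : K := ((b : K) - σ b) / 2 with hy₀
      have hσ2 : σ 2 = 2 := by rw [map_ofNat]
      have hσy₀ : σ y₀ = -y₀ := by rw [hy₀, map_div₀, map_sub, hσσ, hσ2]; ring
      have vy₀ : Valued.v y₀ ≤ 1 := by
        rw [hy₀, map_div₀, h2v, div_one]; exact Valuation.map_sub_le _ b.2 (by rw [hσv]; exact b.2)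
      have vx : Valued.v (t * y₀) ≤ 1 := by rw [map_mul]; exact mul_le_one' ht1 vy₀
      have hσx : σ (t * y₀) = -(t * y₀) := by rw [map_mul, hσt, hσy₀, mul_neg]
      obtain ⟨p, hp, hcoe⟩ := exists_mem_flickerPH_coe_eq σ hJ hd hc (by rw [map_one] : Valued.v (1 : K) = 1) vx hσx
        (by rw [map_one] : Valued.v (1 : K) = 1) (by rw [map_one, mul_one])
      have hp0 : p ∈ flickerPH0 σ J c t := by
        refine (mem_flickerPH0_iff_of_coe_eq σ hJ hσv hσσ hp hcoe (by rw [map_one]) (by rw [map_one]) (by rw [map_one, mul_one]) t).2 ⟨?_, ?_⟩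
        · rw [inv_one, mul_one, sub_self, map_zero]; exact zero_le
        · rw [map_mul]; exact (mul_le_mul' le_rfl vy₀).trans (by rw [mul_one])
      refine ⟨⟨p, hp0⟩, ?_⟩
      change Multiplicative.ofAdd (toQuotPow m (chi p)) = g
      have c1 : chi p = y₀ := by
        rw [hchi p 1 (t * y₀) 1 hcoe one_ne_zero, inv_one, mul_one, map_one, add_sub_cancel_right, mul_div_cancel_left₀ _ ht0]
      rw [c1, ← ofAdd_toAdd g, ← hb, toQuotPow_of_le m vy₀]
      congr 1
      rw [Ideal.Quotient.eq, mem_maximalIdeal_pow_iff_v_le hd.vϖ]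
      rw [← hb, hσq, Ideal.quotientMap_mk, ← map_neg, Ideal.Quotient.eq] at hg
      have hg' := (mem_maximalIdeal_pow_iff_v_le hd.vϖ m _).1 hg
      change Valued.v (σ (b : K) - -(b : K)) ≤ _ at hg'
      change Valued.v (y₀ - (b : K)) ≤ _
      have : y₀ - (b : K) = -(2⁻¹) * (σ (b : K) - -(b : K)) := by rw [hy₀]; field_simp; ring
      rw [this, map_mul, Valuation.map_neg, map_inv₀, h2v, inv_one, one_mul]
      exact hg'
  -- count
  rw [← hker, Subgroup.index_ker]
  refine Nat.card_congr
    { toFun := fun g => ⟨Multiplicative.toAdd g.1, (hrange g.1).1 g.2⟩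
      invFun := fun β => ⟨Multiplicative.ofAdd β.1, (hrange _).2 (by simpa using β.2)⟩
      left_inv := fun g => by simp
      right_inv := fun β => by simp }

end Index

end UnitaryGroup

end Literature.NumberTheory.Automorphic
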